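import Summits.ResolutionOfSingularities.ResolutionOfSingularities.Theorems.PurelyInseparableDim4ResConeCInfLayerStepPrime
import HarnessLib
import HarnessLib.Audit.Tags

/-!
# Purely inseparable four-folds — the LAYER PERSISTS and «regime R», every σ = (n, n) + 0 and every prime: the `1 ↦ n` edition of
# FILE ♯2b `…ResConeCInfLayerStepPrime` (cell `res-dim4-pi`, K2(p) lane, class (iii) rows σ = (n, n) + 0, flagless branch, FILE ♯2bσ)

[OURS · counted 0 · cell `res-dim4-pi` · K2(p) lane (holder res-dim4-p-12 g5, ruling g5-33 «(σ♭) = the `1 ↦ n` port ♯1σ/♯2σ/♯2bσ/TSσ/C♯σ/(I♭)σ»;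
res-dim4-p-3 g6's MEMO `res-dim4-p-3/MEMO-g6-FLAGLESS-SHARP.md` §2 (LAYER), (R); conventions of res-dim4-typ-1 g6 (bus 2026-08-29 15:49Z);
typed by the width seat res-dim4-p-13 g6 by signature).]  Nothing here proves K2(p) for any `p`, any TAIL(p, d, 3), FLAGLESS♯,
`NoIsolatedTrap p p`, the Cossart–Jannsen–Saito theorem or resolution of singularities in dimension ≥ 4 / characteristic `p` — NOT proved.
AI kernel work, weaker than expert review.  Exponent algebra about OUR frame; it kills nothing by itself.

SETTING.  Twin slots `j, i` of weight `n ≥ 1`, free letter `u`, contact letter `f`; `n + d = p`, `2 ≤ d`; F-exponents `(e_j, e_i, e_u, e_f)`.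
A twin-slot state is STRAIGHT if it has order `p + n` and its only degree-`(p + n)` exponent is the cone `x_j^n x_i^n x_f^d`; it has the
σ-LEDGER if «`e_f ≤ d − 1 ⇒ e_j ≥ n + 1 ∧ e_i ≥ n + 1`»; it is LAYER if moreover it has NO monomial of degree `p + n + 1` with `e_f + 2 ≤ d`
(FILE ♯2σ produces the first LAYER state at a letter change).  The translated slot step is `step p univ j (update 0 u β) s`.  For `n = 1`
(`d + 1 = p`) every statement below is literally the corresponding statement of FILE ♯2b.
* §1 **`le_apply_of_layer_step_translate_u_sigma`** — the `κ`-child (any `β`) of a LAYER state has `e_f + 2 ≤ d ⇒ e_j ≥ n + 2` (a residual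
  `κ`-exponent `≤ 1` needs a parent of degree `≤ p + n + 1`, i.e. the cone — wrong contact exponent — or a LAYER-forbidden monomial).  With
  FILE ♯2b's weight-free `le_apply_of_step_translate_other` (an `o`-step keeps every lower bound on `e_j`) this is «REGIME R» for the twin
  slots: from two steps after the letter change on, every monomial with `e_f + 2 ≤ d` has `e_j ≥ n + 2 ∧ e_i ≥ n + 2` while LAYER persists.
* §2 **`layer_step_same_sigma`** — LAYER parent, `κ`-step (β) in regime, next step AGAIN `κ` (β″) in regime ⇒ the `κ`-child is LAYER: its
  degree-`(p + n + 1)` `κ`-lines have members with `e_j ≥ n + 2`, so every Hasse sum along such a line is a coefficient of the grandchild of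
  degree `< p + n + 1` and not the cone, hence `0`; a line all of whose Hasse sums vanish is empty (FILE ♯2 `line_eq_zero_of_hasse_vanish`).
* §3 **`layer_step_change_sigma`** — LAYER parent with the σ-ledger, `κ`-step (β) in regime, next step `o` (β′) in regime, and the `κ`-child
  carries NO σ-`κ`-KILLER `x_j^{a} x_i^{n+1} x_u^{d+n−c−a} x_f^{c}` (`a ≥ n + 2`, `c + 2 ≤ d`) ⇒ the `κ`-child is LAYER: on each
  degree-`(p + n + 1)` `o`-line the member with `e_i = n + 1` would be such a killer, the others have `e_i ≥ n + 2` (σ-ledger of the child,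
  re-derived inline from FILE ♯2's weight-free backward law `exists_parent_of_mem_support_step_translate_u`), and the Hasse sums are again
  grandchild coefficients below the order.
[cite: Hauser2010, §§F–G] [cite: CossartJannsenSaito2020, Lemma 13.2, Thm. 3.14]
bears_on: LADDER-RESOLUTION:D157-DOOR2 (res-dim4-pi · K2(p) · power cones · class (iii) σ = (n,n)+0 flagless branch ♯2bσ).  Supports
stmt-ResolutionOfSingularities-16155 (helper).
-/

set_option linter.dupNamespace false -- mandated namespace of this single-conjunct summit

noncomputable section

namespace Summit.ResolutionOfSingularities.ResolutionOfSingularities.Theorems.PIDim4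

namespace ResCone

open MvPolynomial Finset
open Literature.AlgebraicGeometry.Resolution
open Literature.AlgebraicGeometry.Resolution.CentreBlowup
open Literature.AlgebraicGeometry.Resolution.Hauser2010
open Literature.AlgebraicGeometry.Resolution.HauserPerlega2019

variable {K : Type} [Field K] [DecidableEq K]

section Step

variable {j i u f : Fin 4} (hji : j ≠ i) (hju : j ≠ u) (hjf : j ≠ f) (hiu : i ≠ u) (hif : i ≠ f) (huf : u ≠ f)
include hji hju hjf hiu hif huf

/-! ## 1. Regime R, σ-edition: no residual `κ`-exponent `≤ 1` after a `κ`-step from a LAYER state -/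

/-- **After a `κ`-step from a LAYER twin-slot state every monomial with `e_f + 2 ≤ d` has `e_j ≥ n + 2`** (slots of weight `n`, order
`p + n`; any translation `β·e_u`). The `n = 1` case is FILE ♯2b's `three_le_apply_of_layer_step_translate_u`. [OURS] [cite: Hauser2010, §§F–G] -/
theorem le_apply_of_layer_step_translate_u_sigma (p : ℕ) {n d : ℕ} (s : State K)
    (hq : ((p : ℕ) : ℕ∞) ≤ ordAlong Finset.univ s.F) (h6 : ∀ e ∈ s.F.support, p + n ≤ e.degree)
    (hstraight : ∀ e ∈ s.F.support, e.degree = p + n →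
      e = Finsupp.single j n + Finsupp.single i n + Finsupp.single u 0 + Finsupp.single f d)
    (hlayer : ∀ E : Fin 4 →₀ ℕ, E.degree = p + n + 1 → E f + 2 ≤ d → coeff E s.F = 0) (β : K) :
    ∀ E ∈ (CentreBlowup.step p Finset.univ j (Function.update (0 : Fin 4 → K) u β) s).F.support,
      E f + 2 ≤ d → n + 2 ≤ E j := by
  intro E hE hEf
  obtain ⟨δ, hmem, hm, -, hf, -⟩ := exists_parent_of_mem_support_step_translate_u hji hju hjf hiu hif huf p s hq β hE
  have h6' := h6 δ hmem
  by_contra hlt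
  have hle : δ.degree ≤ p + n + 1 := by omega
  rcases Nat.eq_or_lt_of_le h6' with heq | hgt
  · have hc := hstraight δ hmem heq.symm
    have := (quad_apply hji hju hjf hiu hif huf n n 0 d).2.2.2
    rw [← hc, hf] at this
    omega
  · exact mem_support_iff.mp hmem (hlayer δ (by omega) (by rw [hf]; exact hEf))

/-! ## 2. LAYER persists through a `κ`-step followed by another `κ`-step -/

/-- **LAYER PERSISTS, same letter, σ-edition** (`n + d = p`, `2 ≤ d`): LAYER twin-slot parent `s`; `s₁` = `κ`-step (β) in regime;
`s₂` = `κ`-step (β″) of `s₁` in regime (every monomial of `s₂` has degree `≥ p + n + 1` or is the cone).  Then `s₁` has no monomial of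
degree `p + n + 1` with `e_f + 2 ≤ d`. The `n = 1` case is FILE ♯2b's `layer_step_same_prime`. [OURS] [cite: Hauser2010, §§F–G] -/
theorem layer_step_same_sigma (p : ℕ) {n d : ℕ} (hσ : n + d = p) (hd2 : 2 ≤ d) (s : State K)
    (hq : ((p : ℕ) : ℕ∞) ≤ ordAlong Finset.univ s.F) (h6 : ∀ e ∈ s.F.support, p + n ≤ e.degree)
    (hstraight : ∀ e ∈ s.F.support, e.degree = p + n →
      e = Finsupp.single j n + Finsupp.single i n + Finsupp.single u 0 + Finsupp.single f d)
    (hlayer : ∀ E : Fin 4 →₀ ℕ, E.degree = p + n + 1 → E f + 2 ≤ d → coeff E s.F = 0) (β β'' : K)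
    (hq₁ : ((p : ℕ) : ℕ∞) ≤ ordAlong Finset.univ (CentreBlowup.step p Finset.univ j (Function.update (0 : Fin 4 → K) u β) s).F)
    (hreg₂ : ∀ E ∈ (CentreBlowup.step p Finset.univ j (Function.update (0 : Fin 4 → K) u β'')
        (CentreBlowup.step p Finset.univ j (Function.update (0 : Fin 4 → K) u β) s)).F.support,
      p + n + 1 ≤ E.degree ∨ E = Finsupp.single j n + Finsupp.single i n + Finsupp.single u 0 + Finsupp.single f d) :
    ∀ E : Fin 4 →₀ ℕ, E.degree = p + n + 1 → E f + 2 ≤ d →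
      coeff E (CentreBlowup.step p Finset.univ j (Function.update (0 : Fin 4 → K) u β) s).F = 0 := by
  classical
  set s₁ := CentreBlowup.step p Finset.univ j (Function.update (0 : Fin 4 → K) u β) s with hs₁
  have h3 := le_apply_of_layer_step_translate_u_sigma hji hju hjf hiu hif huf p s hq h6 hstraight hlayer β
  intro E hEdeg hEf
  by_contra hne
  have hmem : E ∈ s₁.F.support := mem_support_iff.mpr hne
  have hEj : n + 2 ≤ E j := h3 E hmem hEf
  have hEquad := degree_eq_quad hji hju hjf hiu hif huf E
  -- the `κ`-line of `E` in `s₁`: members have `e_j ≥ n + 2`, so `e_u ≤ d + n − 1 − E_i − E_f`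
  have htop : ∀ δ ∈ s₁.F.support, δ.degree = p + n + 1 → δ i = E i → δ f = E f → δ u ≤ d + n - 1 - E i - E f := by
    intro δ hδ hm hi' hf'
    have := h3 δ hδ (by omega)
    have := degree_eq_quad hji hju hjf hiu hif huf δ
    omega
  have hvan : ∀ J, J ≤ d + n - 1 - E i - E f →
      ∑ δ ∈ s₁.F.support with (δ.degree = p + n + 1 ∧ δ i = E i ∧ δ f = E f),
        ((δ u).choose J : K) * β'' ^ (δ u - J) * coeff δ s₁.F = 0 := by
    intro J hJ
    set γ : Fin 4 →₀ ℕ := Finsupp.single i (E i) + Finsupp.single u J + Finsupp.single f (E f) with hγ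
    have hγj : γ j = 0 := by
      rw [hγ, Finsupp.add_apply, Finsupp.add_apply, Finsupp.single_eq_of_ne hji, Finsupp.single_eq_of_ne hju,
        Finsupp.single_eq_of_ne hjf]; simp
    have hγi : γ i = E i := by
      rw [hγ, Finsupp.add_apply, Finsupp.add_apply, Finsupp.single_eq_same, Finsupp.single_eq_of_ne hiu,
        Finsupp.single_eq_of_ne hif]; simp
    have hγu : γ u = J := by
      rw [hγ, Finsupp.add_apply, Finsupp.add_apply, Finsupp.single_eq_of_ne hiu.symm, Finsupp.single_eq_same,
        Finsupp.single_eq_of_ne huf]; simp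
    have hγf : γ f = E f := by
      rw [hγ, Finsupp.add_apply, Finsupp.add_apply, Finsupp.single_eq_of_ne hif.symm, Finsupp.single_eq_of_ne huf.symm,
        Finsupp.single_eq_same]; simp
    have hnp : ¬ IsPthPowerExponent p (γ + Finsupp.single j (p + n + 1 - p)) := by
      rw [isPthPowerExponent_iff]
      intro h
      have h2 := h j
      rw [Finsupp.add_apply, hγj, zero_add, Finsupp.single_eq_same, show p + n + 1 - p = n + 1 by omega] at h2
      have := Nat.le_of_dvd (by omega) h2
      omega
    have key := coeff_step_translate_u hji hju hjf hiu hif huf p s₁ hq₁ β'' (show p ≤ p + n + 1 by omega) γ hγj hnp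
    simp only [hγi, hγu, hγf] at key
    rw [← key]
    refine notMem_support_iff.mp fun hmem₂ => ?_
    rcases hreg₂ _ hmem₂ with hge | hcone
    · have hdegγ : (γ + Finsupp.single j (p + n + 1 - p)).degree = E i + J + E f + (p + n + 1 - p) := by
        rw [map_add, Finsupp.degree_single, hγ, map_add, map_add, Finsupp.degree_single, Finsupp.degree_single,
          Finsupp.degree_single]
      have := htop E hmem hEdeg rfl rfl
      rw [hdegγ] at hge
      omega
    · have hj2 : (γ + Finsupp.single j (p + n + 1 - p)) j =
          (Finsupp.single j n + Finsupp.single i n + Finsupp.single u 0 + Finsupp.single f d : Fin 4 →₀ ℕ) j := by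
        rw [hcone]
      rw [Finsupp.add_apply, hγj, Finsupp.single_eq_same, (quad_apply hji hju hjf hiu hif huf n n 0 d).1] at hj2
      omega
  exact hne (line_eq_zero_of_hasse_vanish hji hju hjf hiu hif huf s₁.F (p + n + 1) (E i) (E f) β'' (d + n - 1 - E i - E f) htop
    hvan E hEdeg rfl rfl)

/-! ## 3. LAYER persists through a `κ`-step followed by an `o`-step, if the child carries no σ-`κ`-killer -/

/-- **LAYER PERSISTS, letter change, no killer, σ-edition** (`n + d = p`, `2 ≤ d`): LAYER twin-slot parent `s` with the σ-ledger; `s₁` =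
`κ`-step (β) in regime carrying NO σ-`κ`-killer (`coeff x_j^{a} x_i^{n+1} x_u^{d+n−c−a} x_f^{c} s₁.F = 0` for `n + 2 ≤ a`, `c + 2 ≤ d`);
`s₂` = `o`-step (β′) of `s₁` in regime.  Then `s₁` has no monomial of degree `p + n + 1` with `e_f + 2 ≤ d`. The `n = 1` case is FILE ♯2b's
`layer_step_change_prime`. [OURS] [cite: Hauser2010, §§F–G] [cite: CossartJannsenSaito2020, Lemma 13.2] -/
theorem layer_step_change_sigma (p : ℕ) {n d : ℕ} (hσ : n + d = p) (hd2 : 2 ≤ d) (s : State K)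
    (hq : ((p : ℕ) : ℕ∞) ≤ ordAlong Finset.univ s.F) (h6 : ∀ e ∈ s.F.support, p + n ≤ e.degree)
    (hstraight : ∀ e ∈ s.F.support, e.degree = p + n →
      e = Finsupp.single j n + Finsupp.single i n + Finsupp.single u 0 + Finsupp.single f d)
    (hled : ∀ e ∈ s.F.support, e f ≤ d - 1 → n + 1 ≤ e j ∧ n + 1 ≤ e i)
    (hlayer : ∀ E : Fin 4 →₀ ℕ, E.degree = p + n + 1 → E f + 2 ≤ d → coeff E s.F = 0) (β β' : K)
    (hq₁ : ((p : ℕ) : ℕ∞) ≤ ordAlong Finset.univ (CentreBlowup.step p Finset.univ j (Function.update (0 : Fin 4 → K) u β) s).F)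
    (hnokill : ∀ a c : ℕ, n + 2 ≤ a → c + 2 ≤ d → a ≤ d + n - c →
      coeff (Finsupp.single j a + Finsupp.single i (n + 1) + Finsupp.single u (d + n - c - a) + Finsupp.single f c)
        (CentreBlowup.step p Finset.univ j (Function.update (0 : Fin 4 → K) u β) s).F = 0)
    (hreg₂ : ∀ E ∈ (CentreBlowup.step p Finset.univ i (Function.update (0 : Fin 4 → K) u β')
        (CentreBlowup.step p Finset.univ j (Function.update (0 : Fin 4 → K) u β) s)).F.support,
      p + n + 1 ≤ E.degree ∨ E = Finsupp.single j n + Finsupp.single i n + Finsupp.single u 0 + Finsupp.single f d) :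
    ∀ E : Fin 4 →₀ ℕ, E.degree = p + n + 1 → E f + 2 ≤ d →
      coeff E (CentreBlowup.step p Finset.univ j (Function.update (0 : Fin 4 → K) u β) s).F = 0 := by
  classical
  set s₁ := CentreBlowup.step p Finset.univ j (Function.update (0 : Fin 4 → K) u β) s with hs₁
  have h3 := le_apply_of_layer_step_translate_u_sigma hji hju hjf hiu hif huf p s hq h6 hstraight hlayer β
  -- the σ-ledger of the child (weight-free backward law of FILE ♯2; cf. res-dim4-typ-1 g6's `ledger_step_translate_u_sigma`)
  have hled₁ : ∀ E ∈ s₁.F.support, E f ≤ d - 1 → n + 1 ≤ E j ∧ n + 1 ≤ E i := by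
    intro E hE hEf
    obtain ⟨δ, hmem, hdeg, hi, hf, -⟩ := exists_parent_of_mem_support_step_translate_u hji hju hjf hiu hif huf p s hq β hE
    have hδf : δ f ≤ d - 1 := by rw [hf]; exact hEf
    obtain ⟨-, h2⟩ := hled δ hmem hδf
    have h6' := h6 δ hmem
    refine ⟨?_, by rw [← hi]; exact h2⟩
    rcases Nat.eq_or_lt_of_le h6' with heq | hgt
    · have hc := hstraight δ hmem heq.symm
      have := (quad_apply hji hju hjf hiu hif huf n n 0 d).2.2.2
      rw [← hc] at this
      omega
    · omega
  intro E hEdeg hEf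
  by_contra hne
  have hmem : E ∈ s₁.F.support := mem_support_iff.mpr hne
  have hEj : n + 2 ≤ E j := h3 E hmem hEf
  have hEquad := degree_eq_quad hji hju hjf hiu hif huf E
  have hEi : n + 1 ≤ E i := (hled₁ E hmem (by omega)).2
  -- if `E_i = n + 1` then `E` itself is a σ-`κ`-killer position: absent by hypothesis
  rcases Nat.eq_or_lt_of_le hEi with hEi2 | hEi3
  · apply hne
    have hEu : E u = d + n - E f - E j := by omega
    rw [eq_sum_single_four hji hju hjf hiu hif huf E, ← hEi2, hEu]
    exact hnokill (E j) (E f) hEj hEf (by omega)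
  -- the `o`-line of `E` in `s₁`: members in the support have `e_i ≥ n + 2` (the member with `e_i = n + 1` is the killer, absent)
  have htop : ∀ δ ∈ s₁.F.support, δ.degree = p + n + 1 → δ j = E j → δ f = E f → δ u ≤ d + n - 1 - E j - E f := by
    intro δ hδ hm hj' hf'
    have h2 := (hled₁ δ hδ (by omega)).2
    have hdq := degree_eq_quad hji hju hjf hiu hif huf δ
    by_contra hgt
    have hδi : δ i = n + 1 := by omega
    have hδu : δ u = d + n - E f - E j := by omega
    apply mem_support_iff.mp hδ
    rw [eq_sum_single_four hji hju hjf hiu hif huf δ, hj', hδi, hδu, hf']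
    exact hnokill (E j) (E f) hEj hEf (by omega)
  have hvan : ∀ J, J ≤ d + n - 1 - E j - E f →
      ∑ δ ∈ s₁.F.support with (δ.degree = p + n + 1 ∧ δ j = E j ∧ δ f = E f),
        ((δ u).choose J : K) * β' ^ (δ u - J) * coeff δ s₁.F = 0 := by
    intro J hJ
    set γ' : Fin 4 →₀ ℕ := Finsupp.single j (E j) + Finsupp.single u J + Finsupp.single f (E f) with hγ'
    have hγ'i : γ' i = 0 := by
      rw [hγ', Finsupp.add_apply, Finsupp.add_apply, Finsupp.single_eq_of_ne hji.symm, Finsupp.single_eq_of_ne hiu,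
        Finsupp.single_eq_of_ne hif]; simp
    have hγ'j : γ' j = E j := by
      rw [hγ', Finsupp.add_apply, Finsupp.add_apply, Finsupp.single_eq_same, Finsupp.single_eq_of_ne hju,
        Finsupp.single_eq_of_ne hjf]; simp
    have hγ'u : γ' u = J := by
      rw [hγ', Finsupp.add_apply, Finsupp.add_apply, Finsupp.single_eq_of_ne hju.symm, Finsupp.single_eq_same,
        Finsupp.single_eq_of_ne huf]; simp
    have hγ'f : γ' f = E f := by
      rw [hγ', Finsupp.add_apply, Finsupp.add_apply, Finsupp.single_eq_of_ne hjf.symm, Finsupp.single_eq_of_ne huf.symm,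
        Finsupp.single_eq_same]; simp
    have hnp : ¬ IsPthPowerExponent p (γ' + Finsupp.single i (p + n + 1 - p)) := by
      rw [isPthPowerExponent_iff]
      intro h
      have h2 := h i
      rw [Finsupp.add_apply, hγ'i, zero_add, Finsupp.single_eq_same, show p + n + 1 - p = n + 1 by omega] at h2
      have := Nat.le_of_dvd (by omega) h2
      omega
    have key := coeff_step_translate_u hji.symm hiu hif hju hjf huf p s₁ hq₁ β' (show p ≤ p + n + 1 by omega) γ' hγ'i hnp
    simp only [hγ'j, hγ'u, hγ'f] at key
    rw [← key]
    refine notMem_support_iff.mp fun hmem₂ => ?_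
    rcases hreg₂ _ hmem₂ with hge | hcone
    · have hdegγ : (γ' + Finsupp.single i (p + n + 1 - p)).degree = E j + J + E f + (p + n + 1 - p) := by
        rw [map_add, Finsupp.degree_single, hγ', map_add, map_add, Finsupp.degree_single, Finsupp.degree_single,
          Finsupp.degree_single]
      rw [hdegγ] at hge
      omega
    · have hi2 : (γ' + Finsupp.single i (p + n + 1 - p)) i =
          (Finsupp.single j n + Finsupp.single i n + Finsupp.single u 0 + Finsupp.single f d : Fin 4 →₀ ℕ) i := by
        rw [hcone]
      rw [Finsupp.add_apply, hγ'i, Finsupp.single_eq_same, (quad_apply hji hju hjf hiu hif huf n n 0 d).2.1] at hi2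
      omega
  exact hne (line_eq_zero_of_hasse_vanish hji.symm hiu hif hju hjf huf s₁.F (p + n + 1) (E j) (E f) β' (d + n - 1 - E j - E f) htop
    hvan E hEdeg rfl rfl)

end Step

end ResCone

end Summit.ResolutionOfSingularities.ResolutionOfSingularities.Theorems.PIDim4
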